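import Summits.BirchSwinnertonDyer.BirchSwinnertonDyer.Theorems.SignedBaseChangeAnticyclotomicEisensteinDivisibilityFiniteExponentTelescope
import Literature.NumberTheory.IwasawaTheory.Greenberg2006.CohomologyCofiniteGenerationLeTwoOfTateTC
import Literature.NumberTheory.IwasawaTheory.Greenberg2006.CohomologyCofiniteGenerationHolds
import HarnessLib

/-!
# Crux `AnticyclotomicEisensteinDivisibility` (stmt-BirchSwinnertonDyer-20727), line `bdpline` v37: the Greenberg-2016 road to
# «no pseudo-null submodule / finite exponent of `X_Gr₂[T₁]`» RE-PLUMBED onto Tate's global Euler characteristic AT TOTALLY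
# COMPLEX FIELDS — Greenberg 2006 Prop. 3.2 is no longer carried by name (helper for stmt-BirchSwinnertonDyer-20727)

Lead prover `bsd-line-sbc-p1` gen 14 (cell `bsd-ssimc`). EVENT: the cell `bsd-eis` (line `x1-p1`, lane «PT3-TC») landed
`GaloisCohomology.forall_poitouTate_restricted_three_le_of_isTotallyComplex` (p681302, 2026-08-29): Harari Thm. 17.13 (a) PROVED at
every totally complex number field. Up to skeleton v36 the line carried, inside `stub_namedFactsSS`, Milne ADT I Thm. 5.1
(`tateGlobalEulerPoincareCharacteristic`) and Harari 17.13 (a) (`poitouTate_restricted_three_le`) AT EVERY NUMBER FIELD, consumed through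
Greenberg 2006 Prop. 4.1 and — via NSW (8.3.20) — Prop. 3.2 in EVERY degree (`prop32_cohomology_isCofinitelyGenerated`), although
the road READS both only at the crux's imaginary quadratic `K` (totally complex) and Prop. 3.2 only in degrees `≤ 2` (global clause;
the local clause is the unconditional `Greenberg2006.prop32_local_holds`). This file is the T28-style re-typing (as `bsd-eis` did for
its own chain, `EisensteinPrimes…OfTate`) of the five theorems of the road that carry Prop. 3.2 by name —
`SignedBaseChangeAcDivGreenbergSqueeze.leo_and_crk_fullAt_of_squeeze` (p625450), `SignedBaseChangeAcDivAssembly.{fullAtSelmer_isAlmostDivisible_curve,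
exists_almostDivisible_bridge_curve, xGr₂_hasNoPseudoNullSubmodule_curve}` (p627029), `SignedBaseChangeAcDivFiniteExponentTelescope.finiteExponent_of_bricks`
(p628494) — with `h32 : prop32_cohomology_isCofinitelyGenerated` REPLACED by Tate's formula BY NAME AT TOTALLY COMPLEX FIELDS ONLY,
`hT : ∀ L [IsTotallyComplex L], tateGlobalEulerPoincareCharacteristic L` (the shape the `bsd-eis` lane «TATE-EPC-TC» is proving; read
through `Greenberg2006.prop32_global_le_two_of_tate_tc` in degrees `1, 2` and `prop32_local_holds` locally; LEO by
`AcTwistDeformation.isCotorsion_submodule_of_hasCorank_zero` on `Ш² ≤ H²`); statements otherwise VERBATIM (same binder order, Greenberg 2006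
Prop. 4.1 / 4.2 / §5 A and Greenberg 2016 Props. 4.1.1 / 4.2.2 still by name; names `<name>_ofTateTC`); proofs = the tree proofs with the two
reading lemmas substituted and the re-typed callees called. Sequel (`…OfFiniteExponentTateTC`): the skeleton's finite-exponent statement from
Greenberg 2016 Prop. 4.1.1 + Tate (TC) alone, and the crux's census with that statement as a hypothesis. EFFECT (skeleton v37): conjunct
`∀ K, poitouTate_restricted_three_le K` of `stub_namedFactsSS` GONE, Tate conjunct WEAKENED to totally complex fields; named facts 9 → 8.

Theorems only; no definition, no named fact, no `sorry`, no instance. HONEST FRAMING: conditional on the PUBLISHED named facts carried as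
hypotheses; closes nothing by itself (`--supports stmt-BirchSwinnertonDyer-20727`); no summit statement / BSD / the crux is proved here.

## References
* R. Greenberg, *On the structure of certain Galois cohomology groups*, Doc. Math. Extra Vol. Coates (2006), Prop. 3.2 (p. 358),
  Props. 4.1–4.2 (pp. 367–368), §5 A (p. 373). [Greenberg2006]
* R. Greenberg, *On the structure of Selmer groups*, PROMS 188 (2016), Prop. 4.1.1 (p. 15), Prop. 4.2.2 (p. 20). [Greenberg2016Selmer]
* R. Greenberg, *Surjectivity of the global-to-local map defining a Selmer group*, Kyoto J. Math. 50 (2010), Lemma 5.2.2. [Greenberg2010]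
* J. S. Milne, *Arithmetic Duality Theorems*, 2nd ed. (2006), I Thm. 5.1 (p. 67). [MilneADT2006]
-/

-- `Summit.BirchSwinnertonDyer.BirchSwinnertonDyer.…`: summit and sub-problem share a name (D-0017 layout).
set_option linter.dupNamespace false
set_option autoImplicit false

noncomputable section

open scoped Classical
open NumberField IsDedekindDomain Field
open Literature.NumberTheory.EllipticCurves Literature.NumberTheory.GaloisRepresentations
  Literature.NumberTheory.GaloisCohomology
  Literature.NumberTheory.EllipticCurves.Rubin1991
  Literature.NumberTheory.IwasawaTheory Literature.NumberTheory.IwasawaTheory.Greenberg2006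
  Literature.NumberTheory.IwasawaTheory.Greenberg2016
  Summit.BirchSwinnertonDyer.BirchSwinnertonDyer.Theorems.GreenbergFullAtSelmer
  Summit.BirchSwinnertonDyer.BirchSwinnertonDyer.Theorems.AcTwistDeformation
  Summit.BirchSwinnertonDyer.BirchSwinnertonDyer.Theorems.TwistDeformationCofree
  Summit.BirchSwinnertonDyer.BirchSwinnertonDyer.Theorems.SignedBaseChangeAcDivFiniteExponent
  Summit.BirchSwinnertonDyer.BirchSwinnertonDyer.Theorems.SignedBaseChangeAcDivGreenbergSqueeze
  Summit.BirchSwinnertonDyer.BirchSwinnertonDyer.Theorems.SignedBaseChangeAcDivCurveModel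
  Summit.BirchSwinnertonDyer.BirchSwinnertonDyer.Theorems.SignedBaseChangeAcDivAssembly
  Summit.BirchSwinnertonDyer.BirchSwinnertonDyer.Theorems.SignedBaseChangeAcDivFiniteExponentTelescope

universe u

namespace Summit.BirchSwinnertonDyer.BirchSwinnertonDyer.Theorems.SignedBaseChangeAcDivGreenbergRoadOfTateTC


/-! ## §1 LEO and CRK by the squeeze, Prop. 3.2 read from Tate (TC) in degrees `1, 2` and unconditionally locally -/

section Squeeze

variable {p : ℕ} [Fact p.Prime] {K : Type} [Field K] [NumberField K]
  {S : Set (HeightOneSpectrum (𝓞 K))} {Λ' : Type} [CommRing Λ'] [IsDomain Λ'] [TopologicalSpace Λ']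
  [IsTopologicalRing Λ'] {mΛ : ℕ}
  {D : Type} [AddCommGroup D] [Module Λ' D] [TopologicalSpace D] [DiscreteTopology D]
  [ContinuousSMul Λ' D] (ρ : ContinuousRep (GaloisGroupUnramifiedOutside K S) Λ' D)

/-- **[`OfTateTC` re-typing of `SignedBaseChangeAcDivGreenbergSqueeze.leo_and_crk_fullAt_of_squeeze`: Greenberg 2006 Prop. 3.2 by name ↦
Milne ADT I Thm. 5.1 by name at totally complex fields (Prop. 3.2 is read in degrees `1, 2` globally, `prop32_global_le_two_of_tate_tc`,
and unconditionally locally, `prop32_local_holds`).]** LEO(`𝐃`) ∧ CRK(`𝐃`, `𝓛_η`) ∧ `corank H¹(K_Σ/K, 𝐃) = m` ∧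
`corank H²(K_Σ/K, 𝐃) = 0`, BY THE SQUEEZE, for a cofinitely generated `p`-primary `𝐃` of any corank `m` over a totally imaginary `K`
with `r₂ = 1`; hypotheses and proof otherwise verbatim. [cite: Greenberg2016Selmer, §2.2 p. 6, §2.3 p. 7 L1–17, Prop. 4.1.1 p. 15]
[cite: Greenberg2006, Prop. 3.2 p. 358; Props. 4.1, 4.2 (§4 A pp. 367–368); §5 A (p. 373)] [cite: MilneADT2006, I Thm. 5.1 (p. 67)] -/
theorem leo_and_crk_fullAt_of_squeeze_ofTateTC
    (h41 : prop41_globalEulerPoincareCorank) (h42 : prop42_localEulerPoincareCorank)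
    (hT : ∀ (L : Type) [Field L] [NumberField L] [IsTotallyComplex L], tateGlobalEulerPoincareCharacteristic L)
    (h5A : sec5A_localH2_subsingleton_of_LOC1)
    (hSf : S.Finite) (hS : ∀ v : HeightOneSpectrum (𝓞 K), ((p : ℕ) : 𝓞 K) ∈ v.asIdeal → v ∈ S)
    (hK : ∀ w : InfinitePlace K, w.IsComplex) (hr₂ : InfinitePlace.nrComplexPlaces K = 1)
    (hΛ : Nonempty (Λ' ≃+* MvPowerSeries (Fin mΛ) ℤ_[p]))
    (hp : ∀ d : D, ∃ n : ℕ, (p ^ n : ℤ) • d = 0) (hcf : IsCofinitelyGenerated Λ' D)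
    {m : ℕ} (hm : HasCorank Λ' D m) (h0 : HasCorank Λ' (ρ.H 0) 0)
    {η η' : HeightOneSpectrum (𝓞 K)} (hη' : η' ∈ S) (hne : η' ≠ η)
    (hpη' : ((p : ℕ) : 𝓞 K) ∈ η'.asIdeal)
    (hdeg : η'.asIdeal.ramificationIdx ℤ * η'.asIdeal.inertiaDeg ℤ = 1)
    (hSp : ∀ v : HeightOneSpectrum (𝓞 K), v ∈ S → ((p : ℕ) : 𝓞 K) ∈ v.asIdeal → v = η ∨ v = η')
    (hLOC1 : ∀ v : HeightOneSpectrum (𝓞 K), v ∈ S → LOC1 S ρ (Sum.inr v))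
    (h0loc : ∀ v : HeightOneSpectrum (𝓞 K), v ∈ S → HasCorank Λ' ((localRep S ρ (Sum.inr v)).H 0) 0)
    (hSel : HasCorank Λ' (fullAtSpecification S ρ (Sum.inr η)).selmer 0) :
    LEO S ρ ∧ (fullAtSpecification S ρ (Sum.inr η)).CRK ∧
      HasCorank Λ' (ρ.H 1) m ∧ HasCorank Λ' (ρ.H 2) 0 := by
  haveI : IsTotallyComplex K := ⟨hK⟩
  -- cofinite generation: locally unconditional (Prop. 3.2, local clause), globally in degrees 1, 2 from Tate (TC)
  have hcfg : ∀ (v : Place K) (i : ℕ), IsCofinitelyGenerated Λ' ((localRep S ρ v).H i) :=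
    fun v i ↦ prop32_local_holds p K S hSf hS Λ' mΛ hΛ D ρ hp hcf v i
  have hSelfg : IsCofinitelyGenerated Λ' (fullAtSpecification S ρ (Sum.inr η)).selmer :=
    isCofinitelyGenerated_submodule (prop32_global_le_two_of_tate_tc hT hSf hS hΛ ρ hp hcf 1) _
  -- local coranks: `h²_v = 0` on `S` (§5 A), `h¹_{η'} = m` (Prop. 4.2 (a)), cotorsion elsewhere
  have h2loc : ∀ v : HeightOneSpectrum (𝓞 K), v ∈ S →
      HasCorank Λ' ((localRep S ρ (Sum.inr v)).H 2) 0 := fun v hv ↦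
    hasCorank_localH2_zero_of_sec5A ρ h5A hSf hS hΛ hp hcf (hLOC1 v hv)
  have hη'm : HasCorank Λ' ((localRep S ρ (Sum.inr η')).H 1) m :=
    hasCorank_localH1_of_prop42_degree_one ρ h42 hSf hS hΛ hp hcf hpη' hdeg hm (h0loc η' hη')
      (h2loc η' hη')
  have hcot : ∀ v : Place K, InSigma S v → v ≠ Sum.inr η → v ≠ Sum.inr η' →
      IsCotorsion Λ' ((localRep S ρ v).H 1) := by
    rintro (w | v) hv h1 h2'
    · exact isCotorsion_localH1_inl_of_isComplex S ρ (hK w)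
    · have hvS : v ∈ S := (inSigma_inr_iff S v).mp hv
      have hvη : v ≠ η := fun h ↦ h1 (by rw [h])
      have hvη' : v ≠ η' := fun h ↦ h2' (by rw [h])
      have hvp : ((p : ℕ) : 𝓞 K) ∉ v.asIdeal := fun h ↦ by
        rcases hSp v hvS h with h' | h'
        · exact hvη h'
        · exact hvη' h'
      exact isCotorsion_localH1_of_prop42 ρ h42 hSf hS hΛ hp hcf hvp hm (h0loc v hvS) (h2loc v hvS)
        (hcfg (Sum.inr v) 1)
  -- `Q_{𝓛_η}`: corank `m`, cofinitely generated
  have hQ : HasCorank Λ' (fullAtSpecification S ρ (Sum.inr η)).QGlobal m :=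
    hasCorank_QGlobal_fullAt_of_corank hSf hη' hne hη'm hcot
  have hQfg : IsCofinitelyGenerated Λ' (fullAtSpecification S ρ (Sum.inr η)).QGlobal :=
    isCofinitelyGenerated_QGlobal_fullAt hSf η fun v _ ↦ hcfg v 1
  -- the squeeze (Prop. 4.1 by name)
  obtain ⟨hH1, hH2⟩ := hasCorank_H1_and_H2_zero_of_corank ρ h41 hSf hS hK hr₂ hΛ hp hcf hm h0
    (fullAtSpecification S ρ (Sum.inr η)) hSel hSelfg hQ hQfg
  -- LEO from `corank H² = 0` and cofinite generation of `H²` (Tate (TC), degree 2)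
  exact ⟨isCotorsion_submodule_of_hasCorank_zero (prop32_global_le_two_of_tate_tc hT hSf hS hΛ ρ hp hcf 2) hH2 (sha2 S ρ),
    CRK_fullAt_of_coranks_of_corank hSf hη' hne hH1 hSel hη'm hcot, hH1, hH2⟩

end Squeeze

/-! ## §2 The assembly at `𝐃 = Ind_{K̃_∞/K}(E_K[p^∞])` (twins of p627029) -/

section Assembly

variable {K : Type} [Field K] [NumberField K] {S : Set (HeightOneSpectrum (𝓞 K))} {p : ℕ}
  [Fact p.Prime] (W : WeierstrassCurve K)
  [TopologicalSpace (PowerSeries ℤ_[p])] [TopologicalSpace (PowerSeries (PowerSeries ℤ_[p]))]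
  [IsTopologicalRing (PowerSeries (PowerSeries ℤ_[p]))]
  [IsTopologicalAddGroup (IndModule₂ ℤ_[p] p (PrimaryTorsion W.geomPoints p))]
  [ContinuousSMul (PowerSeries (PowerSeries ℤ_[p])) (IndModule₂ ℤ_[p] p (PrimaryTorsion W.geomPoints p))]
  (hS : ∀ v : HeightOneSpectrum (𝓞 K), ((p : ℕ) : 𝓞 K) ∈ v.asIdeal → v ∈ S)
  (κ₁ κ₂ : ZpExtension K p)
  (ρ₀ : ContinuousRep (GaloisGroupUnramifiedOutside K S) ℤ_[p] (PrimaryTorsion W.geomPoints p))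
  (vbar : HeightOneSpectrum (𝓞 K)) (γ₁ γ₂ : absoluteGaloisGroup K)
  [hγ : Fact (ZpExtension.IsTopGeneratorPair κ₁ κ₂ γ₁ γ₂)]

/-- **[`OfTateTC` re-typing of `SignedBaseChangeAcDivAssembly.fullAtSelmer_isAlmostDivisible_curve`.]** Greenberg 2016 Prop. 4.1.1 (c)
at `𝐃 = Ind_{K̃_∞/K}(E_K[p^∞])`: `S_{𝓛_v}(K, 𝐃)` is almost divisible, granted Greenberg 2016 Props. 4.1.1/4.2.2, Greenberg 2006
§5 A / Props. 4.1 / 4.2 by name and Tate's formula at totally complex fields by name (in place of Prop. 3.2), the line's `Λ₂`-torsion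
of `X_Gr₂`, and the two instance bricks; proof verbatim with `leo_and_crk_fullAt_of_squeeze_ofTateTC`.
[cite: Greenberg2016Selmer, Prop. 4.1.1 (c) (§4.1 p. 15 L21–32), §4.3 p. 20 L19–30]
[cite: Greenberg2006, Props. 4.1, 4.2, §5 A; Thm. 3 p. 342] [cite: Greenberg2010, Lemma 5.2.2] [cite: MilneADT2006, I Thm. 5.1 (p. 67)] -/
theorem fullAtSelmer_isAlmostDivisible_curve_ofTateTC
    (h411 : prop411_selmer_isAlmostDivisible) (h422 : prop422_localCohomology_isAlmostDivisible)
    (h5A : sec5A_localH2_subsingleton_of_LOC1) (h41 : prop41_globalEulerPoincareCorank)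
    (h42 : prop42_localEulerPoincareCorank)
    (hT : ∀ (L : Type) [Field L] [NumberField L] [IsTotallyComplex L], tateGlobalEulerPoincareCharacteristic L)
    (hSf : S.Finite) (hp : 2 < p) (hK : IsImaginaryQuadratic K)
    {v : HeightOneSpectrum (𝓞 K)} (hv : ((p : ℕ) : 𝓞 K) ∈ v.asIdeal)
    (hvbar : ((p : ℕ) : 𝓞 K) ∈ vbar.asIdeal) (hne : vbar ≠ v)
    (hNS : ∀ n ∈ ramificationSubgroup K S, ∀ P : PrimaryTorsion W.geomPoints p, n • P = P)
    (hρ₀ : ∀ (σ : absoluteGaloisGroup K) (P : PrimaryTorsion W.geomPoints p),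
      ρ₀ (toUnramifiedQuot K S σ) P = σ • P)
    (htors : Module.IsTorsion (IwasawaAlgebra₂ p) (W.XGr₂ p κ₁ κ₂ vbar γ₁ γ₂))
    (hcofree : IsCofree ℤ_[p] (PrimaryTorsion W.geomPoints p))
    (hTate : ∃ (Y : Type) (_ : AddCommGroup Y) (_ : Module ℤ_[p] Y)
      (tA : Y →+ (PrimaryTorsion W.geomPoints p →+ DiscreteGaloisModule.UnitsCarrier K))
      (_ : IsDualPairing ℤ_[p] (PrimaryTorsion W.geomPoints p) tA) (n : ℕ),
      Nonempty (Module.Basis (Fin n) ℤ_[p] Y))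
    (hLOC1 : ∀ w : HeightOneSpectrum (𝓞 K), w ∈ S → LOC1 S (twistDeformation S hS κ₁ κ₂ ρ₀) (Sum.inr w))
    (h0loc : ∀ w : HeightOneSpectrum (𝓞 K), w ∈ S →
      HasCorank (IwasawaAlgebra₂ p) ((localRep S (twistDeformation S hS κ₁ κ₂ ρ₀) (Sum.inr w)).H 0) 0)
    (h0 : HasCorank (IwasawaAlgebra₂ p) ((twistDeformation S hS κ₁ κ₂ ρ₀).H 0) 0) :
    IsAlmostDivisible (IwasawaAlgebra₂ p)
      (fullAtSpecification S (twistDeformation S hS κ₁ κ₂ ρ₀) (Sum.inr v)).selmer := by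
  set ρ := twistDeformation S hS κ₁ κ₂ ρ₀ with hρ
  -- standing clauses of the arena at `Λ = R = Λ₂`
  have hΛ := nonempty_iwasawaAlgebraTwoVar_ringEquiv_mvPowerSeries p
  have hcpl := isAdicComplete_maximalIdeal_iwasawaAlgebraTwoVar p
  have hres := finite_residueField_iwasawaAlgebraTwoVar p
  have hchar := charP_residueField_iwasawaAlgebraTwoVar p
  have hinj : Function.Injective
      (algebraMap (PowerSeries (PowerSeries ℤ_[p])) (PowerSeries (PowerSeries ℤ_[p]))) :=
    fun a b h ↦ by simpa using h
  have hfin : Module.Finite (PowerSeries (PowerSeries ℤ_[p])) (PowerSeries (PowerSeries ℤ_[p])) :=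
    inferInstance
  have hlin : ∀ (g : GaloisGroupUnramifiedOutside K S) (r : PowerSeries (PowerSeries ℤ_[p]))
      (d : IndModule₂ ℤ_[p] p (PrimaryTorsion W.geomPoints p)), ρ g (r • d) = r • ρ g d :=
    fun g r d ↦ twistDeformation_smul S hS κ₁ κ₂ ρ₀ g r d
  -- `𝐃`: cofree, cofinitely generated, `p`-primary, RFX, corank `m`
  have hA : ∀ a : PrimaryTorsion W.geomPoints p, ∃ k : ℕ, p ^ k • a = 0 := fun a ↦ by
    obtain ⟨k, hk⟩ := a.exists_pow_smul_eq_zero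
    exact ⟨k, PrimaryTorsion.ext (by rw [PrimaryTorsion.val_nsmul]; exact hk)⟩
  have hTc : IsCofree (PowerSeries (PowerSeries ℤ_[p])) (IndModule₂ ℤ_[p] p (PrimaryTorsion W.geomPoints p)) :=
    IndModule₂.isCofree hA hcofree
  have hcf := IsCofree.isCofinitelyGenerated hTc
  have hRFX : RFX (PowerSeries (PowerSeries ℤ_[p])) (IndModule₂ ℤ_[p] p (PrimaryTorsion W.geomPoints p)) :=
    IndModule₂.rfx hA hcofree
  have hm := IndModule₂.hasCorank (p := p) hA hcofree
  have hpD : ∀ d : IndModule₂ ℤ_[p] p (PrimaryTorsion W.geomPoints p), ∃ n : ℕ, (p ^ n : ℤ) • d = 0 :=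
    IndModule₂.exists_pow_smul_eq_zero
  -- LOC⁽²⁾: at the finite places from LOC⁽¹⁾ and the free Tate duals; at the complex places trivially
  haveI := hK.2
  have hKc : ∀ w : InfinitePlace K, w.IsComplex := IsTotallyComplex.isComplex
  obtain ⟨Y, _, _, tA, hY, n, ⟨b⟩⟩ := hTate
  have hLOC2 : ∀ w : Place K, InSigma S w → LOC2 S ρ w := by
    rintro (w | w) hw
    · exact loc2_inl_of_isComplex S ρ w (hKc w)
    · exact loc2_of_loc1_of_free (hLOC1 w ((inSigma_inr_iff S w).mp hw))
        fun Y' _ _ t' hY' ↦ IndModule₂.free_and_finite_of_isDualPairing hA b hY hY'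
  -- `corank S_{𝓛_v} = 0` from the line's torsion input through the bridge
  have hSel : HasCorank (IwasawaAlgebra₂ p) (fullAtSpecification S ρ (Sum.inr v)).selmer 0 := by
    obtain ⟨e, he⟩ := exists_addEquiv_unrSelmer₂_balanced_curve W hS κ₁ κ₂ ρ₀ vbar γ₁ γ₂ hp hK hv hvbar
      hne hNS hρ₀
    exact hasCorank_zero_of_xGr₂_isTorsion W p κ₁ κ₂ vbar γ₁ γ₂ htors e he
  -- LEO and CRK by the squeeze (η = v, η' = v̄ of local degree one; `r₂ = 1`), Prop. 3.2 read from Tate (TC)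
  have hr₂ := nrComplexPlaces_eq_one_of_isImaginaryQuadratic hK
  have hdeg : vbar.asIdeal.ramificationIdx ℤ * vbar.asIdeal.inertiaDeg ℤ = 1 :=
    (ncard_primesOver_eq_two_and_deg_one_of_ne hK.1 hv hvbar hne).2 hvbar
  have hSp : ∀ w : HeightOneSpectrum (𝓞 K), w ∈ S → ((p : ℕ) : 𝓞 K) ∈ w.asIdeal → w = v ∨ w = vbar :=
    fun w _ hw ↦ eq_or_eq_of_natCast_mem_of_ne hK.1 hv hvbar hne hw
  obtain ⟨hLEO, hCRK, -, -⟩ := leo_and_crk_fullAt_of_squeeze_ofTateTC ρ h41 h42 hT h5A hSf hS hKc hr₂ hΛ hpD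
    hcf hm h0 (hS vbar hvbar) hne hvbar hdeg hSp hLOC1 h0loc hSel
  -- Prop. 4.1.1 (c)
  exact fullAtSelmer_isAlmostDivisible_of_facts h411 h422 h5A hSf hS hΛ hinj hfin hcpl hres hchar
    hlin hTc hcf hpD hRFX hLEO hLOC2 (hS v hv) (hLOC1 v (hS v hv)) hCRK

/-- **[`OfTateTC` re-typing of `SignedBaseChangeAcDivAssembly.exists_almostDivisible_bridge_curve`.]** The bridge hypothesis `hBr`
at the instance: an almost-divisible `Λ₂`-module balanced-isomorphic to `unrSelmer₂ κ₁ κ₂ E_K[p^∞] v̄`, Tate (TC) by name in place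
of Prop. 3.2. [cite: Greenberg2016Selmer, Prop. 4.1.1 p. 15] [cite: Greenberg2006, Thm. 3 p. 342] [cite: MilneADT2006, I Thm. 5.1 (p. 67)] -/
theorem exists_almostDivisible_bridge_curve_ofTateTC
    (h411 : prop411_selmer_isAlmostDivisible) (h422 : prop422_localCohomology_isAlmostDivisible)
    (h5A : sec5A_localH2_subsingleton_of_LOC1) (h41 : prop41_globalEulerPoincareCorank)
    (h42 : prop42_localEulerPoincareCorank)
    (hT : ∀ (L : Type) [Field L] [NumberField L] [IsTotallyComplex L], tateGlobalEulerPoincareCharacteristic L)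
    (hSf : S.Finite) (hp : 2 < p) (hK : IsImaginaryQuadratic K)
    {v : HeightOneSpectrum (𝓞 K)} (hv : ((p : ℕ) : 𝓞 K) ∈ v.asIdeal)
    (hvbar : ((p : ℕ) : 𝓞 K) ∈ vbar.asIdeal) (hne : vbar ≠ v)
    (hNS : ∀ n ∈ ramificationSubgroup K S, ∀ P : PrimaryTorsion W.geomPoints p, n • P = P)
    (hρ₀ : ∀ (σ : absoluteGaloisGroup K) (P : PrimaryTorsion W.geomPoints p),
      ρ₀ (toUnramifiedQuot K S σ) P = σ • P)
    (htors : Module.IsTorsion (IwasawaAlgebra₂ p) (W.XGr₂ p κ₁ κ₂ vbar γ₁ γ₂))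
    (hcofree : IsCofree ℤ_[p] (PrimaryTorsion W.geomPoints p))
    (hTate : ∃ (Y : Type) (_ : AddCommGroup Y) (_ : Module ℤ_[p] Y)
      (tA : Y →+ (PrimaryTorsion W.geomPoints p →+ DiscreteGaloisModule.UnitsCarrier K))
      (_ : IsDualPairing ℤ_[p] (PrimaryTorsion W.geomPoints p) tA) (n : ℕ),
      Nonempty (Module.Basis (Fin n) ℤ_[p] Y))
    (hLOC1 : ∀ w : HeightOneSpectrum (𝓞 K), w ∈ S → LOC1 S (twistDeformation S hS κ₁ κ₂ ρ₀) (Sum.inr w))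
    (h0loc : ∀ w : HeightOneSpectrum (𝓞 K), w ∈ S →
      HasCorank (IwasawaAlgebra₂ p) ((localRep S (twistDeformation S hS κ₁ κ₂ ρ₀) (Sum.inr w)).H 0) 0)
    (h0 : HasCorank (IwasawaAlgebra₂ p) ((twistDeformation S hS κ₁ κ₂ ρ₀).H 0) 0) :
    ∃ (Sgr : Type) (_ : AddCommGroup Sgr) (_ : Module (IwasawaAlgebra₂ p) Sgr)
      (e : Sgr ≃+ unrSelmer₂ κ₁ κ₂ (W.geomPrimaryTorsion p) vbar),
      IsAlmostDivisible (IwasawaAlgebra₂ p) Sgr ∧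
        ∀ (r : IwasawaAlgebra₂ p) (x : W.XGr₂ p κ₁ κ₂ vbar γ₁ γ₂) (c : Sgr), (r • x) (e c) = x (e (r • c)) := by
  obtain ⟨e, he⟩ := exists_addEquiv_unrSelmer₂_balanced_curve W hS κ₁ κ₂ ρ₀ vbar γ₁ γ₂ hp hK hv hvbar
    hne hNS hρ₀
  exact ⟨_, inferInstance, inferInstance, e,
    fullAtSelmer_isAlmostDivisible_curve_ofTateTC W hS κ₁ κ₂ ρ₀ vbar γ₁ γ₂ h411 h422 h5A h41 h42 hT hSf hp
      hK hv hvbar hne hNS hρ₀ htors hcofree hTate hLOC1 h0loc h0, he⟩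

/-- **[`OfTateTC` re-typing of `SignedBaseChangeAcDivAssembly.xGr₂_hasNoPseudoNullSubmodule_curve`.]** `X_Gr(E/K̃_∞)` has no
non-zero pseudo-null `Λ₂`-submodule, Tate (TC) by name in place of Prop. 3.2.
[cite: Greenberg2016Selmer, §1 p. 2, Prop. 4.1.1 p. 15] [cite: BurungaleCastellaSkinner2025, §2.1 p. 6] [cite: MilneADT2006, I Thm. 5.1 (p. 67)] -/
theorem xGr₂_hasNoPseudoNullSubmodule_curve_ofTateTC
    (h411 : prop411_selmer_isAlmostDivisible) (h422 : prop422_localCohomology_isAlmostDivisible)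
    (h5A : sec5A_localH2_subsingleton_of_LOC1) (h41 : prop41_globalEulerPoincareCorank)
    (h42 : prop42_localEulerPoincareCorank)
    (hT : ∀ (L : Type) [Field L] [NumberField L] [IsTotallyComplex L], tateGlobalEulerPoincareCharacteristic L)
    (hSf : S.Finite) (hp : 2 < p) (hK : IsImaginaryQuadratic K)
    {v : HeightOneSpectrum (𝓞 K)} (hv : ((p : ℕ) : 𝓞 K) ∈ v.asIdeal)
    (hvbar : ((p : ℕ) : 𝓞 K) ∈ vbar.asIdeal) (hne : vbar ≠ v)
    (hNS : ∀ n ∈ ramificationSubgroup K S, ∀ P : PrimaryTorsion W.geomPoints p, n • P = P)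
    (hρ₀ : ∀ (σ : absoluteGaloisGroup K) (P : PrimaryTorsion W.geomPoints p),
      ρ₀ (toUnramifiedQuot K S σ) P = σ • P)
    (htors : Module.IsTorsion (IwasawaAlgebra₂ p) (W.XGr₂ p κ₁ κ₂ vbar γ₁ γ₂))
    (hcofree : IsCofree ℤ_[p] (PrimaryTorsion W.geomPoints p))
    (hTate : ∃ (Y : Type) (_ : AddCommGroup Y) (_ : Module ℤ_[p] Y)
      (tA : Y →+ (PrimaryTorsion W.geomPoints p →+ DiscreteGaloisModule.UnitsCarrier K))
      (_ : IsDualPairing ℤ_[p] (PrimaryTorsion W.geomPoints p) tA) (n : ℕ),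
      Nonempty (Module.Basis (Fin n) ℤ_[p] Y))
    (hLOC1 : ∀ w : HeightOneSpectrum (𝓞 K), w ∈ S → LOC1 S (twistDeformation S hS κ₁ κ₂ ρ₀) (Sum.inr w))
    (h0loc : ∀ w : HeightOneSpectrum (𝓞 K), w ∈ S →
      HasCorank (IwasawaAlgebra₂ p) ((localRep S (twistDeformation S hS κ₁ κ₂ ρ₀) (Sum.inr w)).H 0) 0)
    (h0 : HasCorank (IwasawaAlgebra₂ p) ((twistDeformation S hS κ₁ κ₂ ρ₀).H 0) 0) :
    HasNoPseudoNullSubmodule (IwasawaAlgebra₂ p) (W.XGr₂ p κ₁ κ₂ vbar γ₁ γ₂) := by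
  obtain ⟨Sgr, _, _, e, hAD, he⟩ := exists_almostDivisible_bridge_curve_ofTateTC W hS κ₁ κ₂ ρ₀ vbar γ₁ γ₂
    h411 h422 h5A h41 h42 hT hSf hp hK hv hvbar hne hNS hρ₀ htors hcofree hTate hLOC1 h0loc h0
  exact xGr₂_hasNoPseudoNullSubmodule_of_isAlmostDivisible W p κ₁ κ₂ vbar γ₁ γ₂ hAD e he

end Assembly

/-! ## §3 The telescope (twin of p628494) -/

section Telescope

variable {K : Type} [Field K] [NumberField K] {p : ℕ} [Fact p.Prime] (W : WeierstrassCurve K) [W.IsElliptic]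
  [TopologicalSpace (PowerSeries ℤ_[p])] [TopologicalSpace (PowerSeries (PowerSeries ℤ_[p]))]
  [IsTopologicalRing (PowerSeries (PowerSeries ℤ_[p]))]
  [IsTopologicalAddGroup (IndModule₂ ℤ_[p] p (PrimaryTorsion W.geomPoints p))]
  [ContinuousSMul (PowerSeries (PowerSeries ℤ_[p])) (IndModule₂ ℤ_[p] p (PrimaryTorsion W.geomPoints p))]
  (κ₁ κ₂ : ZpExtension K p) (vbar : HeightOneSpectrum (𝓞 K)) (γ₁ γ₂ : absoluteGaloisGroup K)
  [hγ : Fact (ZpExtension.IsTopGeneratorPair κ₁ κ₂ γ₁ γ₂)]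

/-- **[`OfTateTC` re-typing of `SignedBaseChangeAcDivFiniteExponentTelescope.finiteExponent_of_bricks`.]** The telescope (R3′):
at `length_{(T₁)}(X_Gr₂) = 0` a power of `p` kills `X_Gr₂[T₁]`, for an elliptic `W` over an imaginary quadratic `K`, `2 < p = v v̄`,
a generator pair, granted Greenberg 2016 Props. 4.1.1/4.2.2, Greenberg 2006 §5 A / Props. 4.1 / 4.2 by name and TATE'S FORMULA AT
TOTALLY COMPLEX FIELDS by name (in place of Greenberg 2006 Prop. 3.2), (R1a) and (R1b); proof verbatim with
`xGr₂_hasNoPseudoNullSubmodule_curve_ofTateTC`. [cite: Greenberg2016Selmer, Prop. 4.1.1 (c) (§4.1 p. 15)]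
[cite: Greenberg2006, Props. 4.1, 4.2, §5 A] [cite: Greenberg2010, Lemma 5.2.2] [cite: MilneADT2006, I Thm. 5.1 (p. 67)] -/
theorem finiteExponent_of_bricks_ofTateTC
    (h411 : prop411_selmer_isAlmostDivisible) (h422 : prop422_localCohomology_isAlmostDivisible)
    (h5A : sec5A_localH2_subsingleton_of_LOC1) (h41 : prop41_globalEulerPoincareCorank)
    (h42 : prop42_localEulerPoincareCorank)
    (hT : ∀ (L : Type) [Field L] [NumberField L] [IsTotallyComplex L], tateGlobalEulerPoincareCharacteristic L)
    (hp : 2 < p) (hK : IsImaginaryQuadratic K)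
    {v : HeightOneSpectrum (𝓞 K)} (hv : ((p : ℕ) : 𝓞 K) ∈ v.asIdeal)
    (hvbar : ((p : ℕ) : 𝓞 K) ∈ vbar.asIdeal) (hne : vbar ≠ v)
    -- (R1a)
    (hcofree : IsCofree ℤ_[p] (PrimaryTorsion W.geomPoints p))
    (hTate : ∃ (Y : Type) (_ : AddCommGroup Y) (_ : Module ℤ_[p] Y)
      (tA : Y →+ (PrimaryTorsion W.geomPoints p →+ DiscreteGaloisModule.UnitsCarrier K))
      (_ : IsDualPairing ℤ_[p] (PrimaryTorsion W.geomPoints p) tA) (n : ℕ),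
      Nonempty (Module.Basis (Fin n) ℤ_[p] Y))
    -- (R1b) for the canonical `S` and every descended `ρ₀`
    (hR1b : ∀ (ρ₀ : ContinuousRep
        (GaloisGroupUnramifiedOutside K {w : HeightOneSpectrum (𝓞 K) | ((p : ℕ) : 𝓞 K) ∈ w.asIdeal ∨ ¬ W.HasGoodReductionAt w})
        ℤ_[p] (PrimaryTorsion W.geomPoints p)),
      (∀ (σ : absoluteGaloisGroup K) (P : PrimaryTorsion W.geomPoints p),
        ρ₀ (toUnramifiedQuot K _ σ) P = σ • P) →
      (∀ w : HeightOneSpectrum (𝓞 K), w ∈ {w : HeightOneSpectrum (𝓞 K) | ((p : ℕ) : 𝓞 K) ∈ w.asIdeal ∨ ¬ W.HasGoodReductionAt w} →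
          LOC1 _ (twistDeformation _ (mem_badOrP_of_natCast_mem W p) κ₁ κ₂ ρ₀) (Sum.inr w)) ∧
        (∀ w : HeightOneSpectrum (𝓞 K), w ∈ {w : HeightOneSpectrum (𝓞 K) | ((p : ℕ) : 𝓞 K) ∈ w.asIdeal ∨ ¬ W.HasGoodReductionAt w} →
          HasCorank (IwasawaAlgebra₂ p)
            ((localRep _ (twistDeformation _ (mem_badOrP_of_natCast_mem W p) κ₁ κ₂ ρ₀) (Sum.inr w)).H 0) 0) ∧
        HasCorank (IwasawaAlgebra₂ p)
          ((twistDeformation _ (mem_badOrP_of_natCast_mem W p) κ₁ κ₂ ρ₀).H 0) 0)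
    (h0 : Literature.NumberTheory.EllipticCurves.Module.lengthAt (IwasawaAlgebra₂ p) (W.XGr₂ p κ₁ κ₂ vbar γ₁ γ₂)
      ⟨Ideal.span {(PowerSeries.X : IwasawaAlgebra₂ p)}, PowerSeries.span_X_isPrime⟩ = 0) :
    ∃ m : ℕ, ∀ x : W.XGr₂ p κ₁ κ₂ vbar γ₁ γ₂,
      (PowerSeries.X : IwasawaAlgebra₂ p) • x = 0 → ((p : IwasawaAlgebra₂ p) ^ m) • x = 0 := by
  set S : Set (HeightOneSpectrum (𝓞 K)) :=
    {w : HeightOneSpectrum (𝓞 K) | ((p : ℕ) : 𝓞 K) ∈ w.asIdeal ∨ ¬ W.HasGoodReductionAt w} with hSdef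
  have hS : ∀ w : HeightOneSpectrum (𝓞 K), ((p : ℕ) : 𝓞 K) ∈ w.asIdeal → w ∈ S :=
    mem_badOrP_of_natCast_mem W p
  have hSbad : ∀ w : HeightOneSpectrum (𝓞 K), ¬ W.HasGoodReductionAt w → w ∈ S := fun w hw ↦ Or.inr hw
  have hSf : S.Finite := by
    refine ((IsDedekindDomain.HeightOneSpectrum.finite_setOf_natCast_mem (R := 𝓞 K)
      (Fact.out : p.Prime).ne_zero).union (W.finite_badPlaces_holds (𝓞 K))).subset ?_
    rintro w (hw | hw)
    · exact Or.inl hw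
    · exact Or.inr hw
  -- Néron–Ogg–Shafarevich and the descended `ρ₀`
  have hNS : ∀ n ∈ ramificationSubgroup K S, ∀ P : PrimaryTorsion W.geomPoints p, n • P = P :=
    fun n hn P ↦ smul_primaryTorsion_eq_of_mem_ramificationSubgroup W p S hSbad hS hn P
  obtain ⟨ρ₀, hρ₀⟩ := exists_continuousRep_primaryTorsion W p S hNS
  obtain ⟨hLOC1, h0loc, h00⟩ := hR1b ρ₀ hρ₀
  -- torsion from the length hypothesis
  have htors := xGr₂_isTorsion_of_lengthAt_eq_zero W κ₁ κ₂ vbar γ₁ γ₂ h0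
  -- no non-zero pseudo-null submodule (the re-typed assembly), hence `m = 0`
  have hPN := xGr₂_hasNoPseudoNullSubmodule_curve_ofTateTC W hS κ₁ κ₂ ρ₀ vbar γ₁ γ₂ h411 h422 h5A h41 h42 hT
    hSf hp hK hv hvbar hne hNS hρ₀ htors hcofree hTate hLOC1 h0loc h00
  exact SignedBaseChangeAcDivSpecialization.S2.pow_smul_torsionBy_eq_zero_of_noPseudoNull p _ h0
    ((hasNoPseudoNullSubmodule_iff _).1 hPN)

end Telescope

end Summit.BirchSwinnertonDyer.BirchSwinnertonDyer.Theorems.SignedBaseChangeAcDivGreenbergRoadOfTateTC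

end
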